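import Mathlib
import Literature.Computability.Complexity.OccurrenceObstructionsIPProofs
import Summits.ValiantsHypothesis.ValiantsHypothesis.Theorems.ValuativeGCTValuativeFlipTwistedInheritance
import Summits.ValiantsHypothesis.ValiantsHypothesis.Theorems.ValuativeGCTValuativeFlipEvalCertificates
import Summits.ValiantsHypothesis.ValiantsHypothesis.Theorems.ValuativeGCTValuativeFlipTwistPolynomial

/-!
# `ValuativeGCT.ValuativeFlip` (stmt-ValiantsHypothesis-12624): EVENTUAL INHERITANCE — BLMW Problem 6.10 "≥"
# holds for all but at most `P_n(μ)·nδ` paddings — size-transfer axis, part V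

Crux `ValuativeFlip` of route `ValuativeGCT`; wall-breaker k12/16 (axis "representation-stability transfer
between `m` and `m + 1`"), 2026-08-16.  The per-side `m ↦ m + j` transfer of the FULL multiplicity,
`P_n(μ) := mult_{μ*} ℂ[Δ_n(per_n)] ≤ mult_{(μ♯(n+j))*} ℂ[Δ_{n+j}(X₀₀^j per_n)]` (`μ♯ = rowLift μ j`), is the
"≥" half of BLMW 2011 §6.4 Problem 6.10 for `g = per_n` — open in print, the dead stub `stub_perAnchorInheritance`
of line `per-anchor-catch-up`, and NOT delivered by the Kadish–Landsberg lift because of BIP's twist `Δ_j`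
(`…PaddingLift`, `Cruxes/ValuativeFlip/DrefuteG2StubPerAnchorInheritance.md`).  This file proves it for all but
FINITELY MANY paddings, with an explicit count:

* (`…TwistPolynomial`) `exists_twistPolyMatrix` — THE TWIST IS POLYNOMIAL IN THE PADDING: on a monomial `x^e` BIP's factor is
  `(e_top + j)!/e_top! = j! · w_{e_top}(j)`, `w_e(t) = (t+1)(t+2)⋯(t+e)/e!` a polynomial of degree `e ≤ n`
  (`factorial_mul_eval_twistPoly`), so for forms `F_i` of degree `δ` the Δ_j-twisted evaluation matrix at ANY
  coefficient vectors is `(j!)^δ` times the specialisation at `t = j` of ONE matrix over `ℂ[t]` with entries of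
  degree `≤ nδ`, whose specialisation at `t = 0` is the UNTWISTED matrix;
* `twistedDet_ne_zero_cofinite` — hence a nonsingular untwisted matrix stays nonsingular after twisting for all
  `j` outside the natural roots of a nonzero polynomial of degree `≤ D·nδ`: at most `D·nδ` exceptions
  (`natDegree_aeval_le_of_isHomogeneous`, `natDegree_det_le_of_forall_le`);
* `eventualInheritance_of_certificate`, `exceptionalPaddings_card_le` — with the landed `stub_twistedInheritance`
  (`…TwistedInheritance`): an untwisted certificate `(F, A)` of size `D` for `μ` at the bottom gives
  `D ≤ mult_{(μ♯(n+j))*} ℂ[Δ_{n+j}(X₀₀^j per_n)]` for all `j ≥ j₀`, indeed for all `j` off ≤ `D·nδ` exceptions;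
* `eventualInheritance` (registered stub of this seat, UNCONDITIONAL over the landed `stub_twistedInheritance`; the
  parallel file `…EventualInheritance` of wall-breaker k4 gen1 proves the conditional form
  `eventualInheritance_of_twistedInheritance` with its own twist algebra, and `…DetEventualMonotone` the determinant
  side `det_eventualMonotone`), `eventualInheritance_uniform`
  (one `j₀(n, δ)` for all shapes `μ ⊢ nδ`), `exceptionalPaddings_card_le_orbitMultiplicity` (at most `P_n(μ)·nδ`
  exceptional paddings) — by the completeness of certificates `exists_certificate_orbitMultiplicity`
  (`…EvalCertificates`).

What it gives the crux (AXIS.md): the per-anchor mechanism `dim T_U(μ♯m) < P_n(μ) ≤ mult_pp(μ♯m)` — and with it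
every lower bound for the UNPADDED permanent's orbit closure (Chow, power-sum, seed certificates) — is valid at
all paddings `j = m - n` off an explicit finite exceptional set; the tail's isotypic difficulty (growth of `P_n`
against the det-side census) is untouched.  The same polynomial structure serves the determinant side
(`…DetEventualMonotone`, landed in parallel: `K_n(μ) ≤ K_{n+j}(μ♯(n+j))` for all large `j`).

Sources: BLMW, SIAM J. Comput. 40 (2011) §6.4 Problem 6.10; Ikenmeyer–Panova 2017 Prop. 2.6(b);
Bürgisser–Ikenmeyer–Panova 2019 Lemma 5.2, Thm. 5.4; Mulmuley–Sohoni 2001 §4–5.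
-/

set_option linter.dupNamespace false

namespace Summit.ValiantsHypothesis.ValiantsHypothesis.Theorems.ValuativeFlip

open scoped BigOperators
open MvPolynomial
open Literature.NumberTheory.DiophantineGeometry
open Literature.Computability.AlgebraicComplexity
open Literature.Computability.Complexity

noncomputable section

/-! ## Eventual inheritance for the padded permanent -/

/-- **At most `D·nδ` exceptional paddings for one certificate.**  Let `F₁ … F_D` be highest-weight vectors of
weight `μ*` (`μ ⊢ nδ`, `≤ n²` parts) on `ℂ[Sym^n ℂ^{n²}]` and `A₁ … A_D ∈ Mat_{n²}` with NONSINGULAR untwisted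
evaluation matrix `(F_i(A_l · per_n))`.  Then `D ≤ mult_{(μ♯(n+j))*} ℂ[Δ_{n+j}(X₀₀^j per_n)]` for all paddings `j`
outside a set of at most `D·nδ` natural numbers (`twistedDet_ne_zero_cofinite` + the landed
`stub_twistedInheritance`). [BLMW 2011 §6.4 Problem 6.10; this crux] -/
theorem exceptionalPaddings_card_le (n δ : ℕ) [NeZero n] (μ : Nat.Partition (n * δ))
    (hμ : μ.parts.card ≤ n * n) (D : ℕ) (F : Fin D → MvPolynomial (DegIdx (MatIdx n) n) ℂ)
    (hF : ∀ i, F i ∈ highestWeightSpace (coordRep (MatIdx n) ℂ n) (partitionWeightLex n μ))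
    (A : Fin D → Matrix (MatIdx n) (MatIdx n) ℂ)
    (hdet : (Matrix.of fun i l : Fin D =>
      MvPolynomial.aeval (formCoeff n (linSubst (MatIdx n) ℂ (A l) (paddedPerFormLex ℂ n n))) (F i)).det ≠ 0) :
    ∃ E : Finset ℕ, E.card ≤ D * (n * δ) ∧ ∀ j : ℕ, j ∉ E → ∀ [NeZero (n + j)],
      D ≤ orbitMultiplicity ℂ (paddedPerFormLex ℂ n (n + j)) (n + j) (partitionWeightLex (n + j) (rowLift μ j)) := by
  have hhom : ∀ i, (F i).IsHomogeneous δ := fun i =>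
    isHomogeneous_of_mem_highestWeightSpace (NeZero.ne n) (hF i) (size_partitionWeightLex' μ hμ)
  obtain ⟨E, hcard, hE⟩ := twistedDet_ne_zero_cofinite n F hhom
    (fun l => linSubst (MatIdx n) ℂ (A l) (paddedPerFormLex ℂ n n)) hdet
  exact ⟨E, hcard, fun j hj _ => stub_twistedInheritance n j δ μ hμ D F hF A (hE j hj)⟩

/-- **Eventual inheritance from one untwisted certificate**: under the same hypotheses,
`D ≤ mult_{(μ♯(n+j))*} ℂ[Δ_{n+j}(X₀₀^j per_n)]` for all `j ≥ j₀`. [BLMW 2011 §6.4 Problem 6.10; this crux] -/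
theorem eventualInheritance_of_certificate (n δ : ℕ) [NeZero n] (μ : Nat.Partition (n * δ))
    (hμ : μ.parts.card ≤ n * n) (D : ℕ) (F : Fin D → MvPolynomial (DegIdx (MatIdx n) n) ℂ)
    (hF : ∀ i, F i ∈ highestWeightSpace (coordRep (MatIdx n) ℂ n) (partitionWeightLex n μ))
    (A : Fin D → Matrix (MatIdx n) (MatIdx n) ℂ)
    (hdet : (Matrix.of fun i l : Fin D =>
      MvPolynomial.aeval (formCoeff n (linSubst (MatIdx n) ℂ (A l) (paddedPerFormLex ℂ n n))) (F i)).det ≠ 0) :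
    ∃ j₀ : ℕ, ∀ j : ℕ, j₀ ≤ j → ∀ [NeZero (n + j)],
      D ≤ orbitMultiplicity ℂ (paddedPerFormLex ℂ n (n + j)) (n + j) (partitionWeightLex (n + j) (rowLift μ j)) := by
  have hhom : ∀ i, (F i).IsHomogeneous δ := fun i =>
    isHomogeneous_of_mem_highestWeightSpace (NeZero.ne n) (hF i) (size_partitionWeightLex' μ hμ)
  obtain ⟨j₀, hj₀⟩ := twistedDet_ne_zero_eventually n F hhom
    (fun l => linSubst (MatIdx n) ℂ (A l) (paddedPerFormLex ℂ n n)) hdet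
  exact ⟨j₀, fun j hj _ => stub_twistedInheritance n j δ μ hμ D F hF A (hj₀ j hj)⟩

/-- **EVENTUAL INHERITANCE (BLMW 2011 Problem 6.10, "≥" half, for padded permanents and all large paddings).**
For every inner size `n`, degree `δ` and shape `μ ⊢ nδ` with at most `n²` parts there is `j₀` such that for
every padding `j ≥ j₀`:
`mult_{μ*} ℂ[Δ_n(per_n)] ≤ mult_{(μ♯(n+j))*} ℂ[Δ_{n+j}(X₀₀^j per_n)]`, `μ♯(n+j) = rowLift μ j = (μ₁ + jδ, μ₂, …)`
(`exists_certificate_orbitMultiplicity` + `eventualInheritance_of_certificate`).  The untwisted inequality for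
EVERY `j` (the dead `stub_perAnchorInheritance`) stays open. [BLMW 2011 §6.4 Problem 6.10; this crux] -/
theorem eventualInheritance (n δ : ℕ) [NeZero n] (μ : Nat.Partition (n * δ)) (hμ : μ.parts.card ≤ n * n) :
    ∃ j₀ : ℕ, ∀ j : ℕ, j₀ ≤ j → ∀ [NeZero (n + j)],
      orbitMultiplicity ℂ (paddedPerFormLex ℂ n n) n (partitionWeightLex n μ) ≤
        orbitMultiplicity ℂ (paddedPerFormLex ℂ n (n + j)) (n + j) (partitionWeightLex (n + j) (rowLift μ j)) := by
  obtain ⟨F, A, hF, hdet⟩ := exists_certificate_orbitMultiplicity (paddedPerFormLex ℂ n n) n (NeZero.ne n)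
    (partitionWeightLex n μ)
  exact eventualInheritance_of_certificate n δ μ hμ _ F hF A hdet

/-- **At most `P_n(μ)·nδ` exceptional paddings**: `mult_{μ*} ℂ[Δ_n(per_n)] ≤ mult_{(μ♯(n+j))*} ℂ[Δ_{n+j}(X₀₀^j per_n)]`
for all `j` outside a set of at most `P_n(μ)·(n·δ)` natural numbers. [BLMW 2011 §6.4 Problem 6.10; this crux] -/
theorem exceptionalPaddings_card_le_orbitMultiplicity (n δ : ℕ) [NeZero n] (μ : Nat.Partition (n * δ))
    (hμ : μ.parts.card ≤ n * n) :
    ∃ E : Finset ℕ, E.card ≤ orbitMultiplicity ℂ (paddedPerFormLex ℂ n n) n (partitionWeightLex n μ) * (n * δ) ∧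
      ∀ j : ℕ, j ∉ E → ∀ [NeZero (n + j)],
        orbitMultiplicity ℂ (paddedPerFormLex ℂ n n) n (partitionWeightLex n μ) ≤
          orbitMultiplicity ℂ (paddedPerFormLex ℂ n (n + j)) (n + j) (partitionWeightLex (n + j) (rowLift μ j)) := by
  obtain ⟨F, A, hF, hdet⟩ := exists_certificate_orbitMultiplicity (paddedPerFormLex ℂ n n) n (NeZero.ne n)
    (partitionWeightLex n μ)
  exact exceptionalPaddings_card_le n δ μ hμ _ F hF A hdet

/-- **Eventual inheritance, uniformly in the shape**: one `j₀ = j₀(n, δ)` serves every `μ ⊢ nδ` with at most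
`n²` parts (finitely many shapes). [BLMW 2011 §6.4 Problem 6.10; this crux] -/
theorem eventualInheritance_uniform (n δ : ℕ) [NeZero n] :
    ∃ j₀ : ℕ, ∀ j : ℕ, j₀ ≤ j → ∀ [NeZero (n + j)] (μ : Nat.Partition (n * δ)), μ.parts.card ≤ n * n →
      orbitMultiplicity ℂ (paddedPerFormLex ℂ n n) n (partitionWeightLex n μ) ≤
        orbitMultiplicity ℂ (paddedPerFormLex ℂ n (n + j)) (n + j) (partitionWeightLex (n + j) (rowLift μ j)) := by
  classical
  have hex : ∀ μ : Nat.Partition (n * δ), ∃ j₀ : ℕ, ∀ j : ℕ, j₀ ≤ j → ∀ [NeZero (n + j)],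
      μ.parts.card ≤ n * n →
        orbitMultiplicity ℂ (paddedPerFormLex ℂ n n) n (partitionWeightLex n μ) ≤
          orbitMultiplicity ℂ (paddedPerFormLex ℂ n (n + j)) (n + j) (partitionWeightLex (n + j) (rowLift μ j)) := by
    intro μ
    by_cases hμ : μ.parts.card ≤ n * n
    · obtain ⟨j₀, h⟩ := eventualInheritance n δ μ hμ
      exact ⟨j₀, fun j hj _ _ => h j hj⟩
    · exact ⟨0, fun j _ _ h => absurd h hμ⟩
  choose j₀ hj₀ using hex
  exact ⟨Finset.univ.sup j₀, fun j hj _ μ hμ => hj₀ μ j ((Finset.le_sup (Finset.mem_univ μ)).trans hj) hμ⟩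

end

end Summit.ValiantsHypothesis.ValiantsHypothesis.Theorems.ValuativeFlip
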